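import Summits.QuantumFields.YangMills.Theorems.BalabanUVNodesN07Thm4RecordStructure
import HarnessLib

/-!
# N07 [B11] (= [15]) Sect. F — A6 CERTIFICATE FOR THE NAMED PREMISE `HThm4Rec`: its ∃-conclusion (HS3NORM-67c's rows + `NrmOfRecordWide`) is INHABITED AT THE TRIVIAL FIELD
# (`U := 1`, gauge `u := 1`, potential `A := 0`) — so the conditional premise of N07's knit of record is not false-by-shape at the trivial point

Cell `pub-ymgap`, width seat `pub-ymgap-dag-n07-w3` g8 (plan g90 RULING A3, item (P1)(iii′) = S1ᶜ; sibling of `…N07Thm4RecordStructure`).  `--kind proof --supports stmt-QuantumFields-20541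
--as helper` (K0⁷; count-neutral).  CONSUMED BY NAME, nothing modified: dag-n07-e's MODULE 60′ `NrmOfRecordWide` and `T4AxialGaugeRooted.axialGaugeAt`, n07-w6's
`N07RadialAxialTower.radialTower_one` ∕ `Node00.ShearedAveragingRecord.gaugeAvgIter_loopAvgBlockOp_one`, r-N12's `B15Claim189UnitTestAtRecord.iter_avOfRecord_one`, `B12RegularSpaces111Mono.expI_zero`.
WHAT IS PROVED (bookkeeping only): `axialGaugeAt_one` (the centre-rooted torus axial gauge of `1` is `1`), `gaugeAct_one_one`, ★ `nrmOfRecordWide_one` (`NrmOfRecordWide … 1 j idx 1 A`: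
witness `w := 1`, `M^i(1) = 1` radial-axial, top gauge `1`, `R̄^{j′}1 = 1`), ★★ `hThm4Rec_conclusion_at_one` (for `0 < κ`, `0 < ε_j`, every run and datum: `u := 1`, `A := 0` satisfy the
ten rows of `HThm4Rec`'s conclusion at `U := 1` — `1 = e^{0}`, `‖0‖ < κ·ε_j·(…)`, the (153) row is a linear map at `0`).  It does NOT prove the premise.
HONEST FRAMING: `HThm4Rec` stays a CONDITIONAL premise (print-licensed [I] p.253–254, not print-proved for the (0.4) structure; N05-REC L++ not commissioned); K0⁷ ∕ K1⁹ NOT closed; N07 ∕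
N05 NOT discharged, N07 NOT claimable on road (β); counts unmoved; one finite 𝕋⁴ programme at fixed ε — R4 closes the conditional finite-𝕋⁴ rung `BalabanLadder.UV` ONLY; the YM mass
gap (Clay) is NOT proved by any of this; nothing continuum ∕ ℝ⁴ ∕ OS.  No `def`, no `instance`, no `notation`, no `sorry`.
References: [Balaban1985Variational] (147)–(153) p. 301; [Balaban1985Averaging] (79)–(81) p. 30; [Balaban1985RegularSpaces] (1.38) p. 82.
-/

set_option autoImplicit false

noncomputable section

open scoped BigOperators Matrix.Norms.L2Operator

namespace Summit.QuantumFields.YangMills.BalabanUVNodes.N07Thm4RecordStructure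

open Literature.MathematicalPhysics.QuantumFieldTheory.Balaban1983to89
open Literature.MathematicalPhysics.QuantumFieldTheory.Balaban1983to89.Node00
open Literature.MathematicalPhysics.QuantumFieldTheory.Balaban1983to89.B15DeterminingSets
open Literature.MathematicalPhysics.QuantumFieldTheory.Balaban1983to89.B12RegularSpaces111 (gaugeU expI grad)
open B15Eq112TorusCover (cover)
open B14DomainGeom (Pt Within)
open B8Eq131Cubes (box cube)
open B6SectADomainsV1 (Domains)
open B6SectAOperatorsV1 (RE dsE QpE)
open Literature.MathematicalPhysics.QuantumFieldTheory.BalabanImbrieJaffe1984to88.BIJ85AxialPropagator411 (BondSpace)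
open T4Continuum (T4Family)
open Summit.QuantumFields.YangMills.BalabanUVNodes.N07NormalisationOfRecordWide (NrmOfRecordWide)

variable {F : T4Family} {N : ℕ} [NeZero N]

/-! ## §4  A6 certificate: the premise's conclusion is inhabited at the trivial field (`U = 1`: `u = 1`, `A = 0`) -/

section Vacuity

open T4AxialGaugeRooted (axialGaugeAt)
open B15Eq177GaugeInvariance (blockLift)
open B12GaugeOrbits021 (IsResidual)
open GaugeField (gaugeAct)
open ExpMeanLog (expMeanLogSU)
open B8Eq131Cubes (tLo tHi ctr)
open Summit.QuantumFields.Balaban3D.Carriers (radialContourData)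
open Summit.QuantumFields.YangMills.BalabanUVNodes.N07RadialAxialTower (radialTower_one)

omit [NeZero N] in
/-- The centre-rooted torus axial gauge of the trivial configuration is trivial. [cite: Balaban1985Variational, (147) p.301 (bookkeeping)] -/
theorem axialGaugeAt_one {P : Params} {j : ℕ} {G : Type*} [GaugeGroup G] (lo hi r : Fin P.d → ℤ) :
    axialGaugeAt (1 : GaugeField P j G) lo hi r = fun _ => 1 := by
  funext s
  unfold axialGaugeAt
  split_ifs with h
  · exact B8Ineq130.axialFn_one _ _
  · rfl

/-- The trivial gauge acting on the trivial field gives the trivial field. [cite: Balaban1985Averaging, (8) p.18 (bookkeeping)] -/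
theorem gaugeAct_one_one {P : Params} {j : ℕ} {G : Type*} [GaugeGroup G] :
    gaugeAct (fun _ => 1 : GaugeTransf P j G) (1 : GaugeField P j G) = 1 := by
  funext b
  show (1 : G) * (1 : GaugeField P j G) b * (1 : G)⁻¹ = (1 : GaugeField P j G) b
  simp

/-- ★ **A6 CERTIFICATE FOR `NrmOfRecordWide` AT THE TRIVIAL FIELD**: `NrmOfRecordWide F N Mc ρ ν M g K k s 1 j idx 1 A` holds (witness `w := 1`: residual, `M^i(1) = 1` is radial-axial,
the top axial gauge of `M^j(1) = 1` is `1`, and `R̄^{j′}1 = 1`). [cite: Balaban1985Variational, (152) p.301; Balaban1985Averaging, (79)–(81) p.30 (bookkeeping)] -/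
theorem nrmOfRecordWide_one (Mc ρ : ℕ) (ν : Stage7Numerics) (M : ℕ) (g : ℕ → ℝ) (K k : ℕ) (s : SeqOfRecord F ν M g K k) (j : ℕ) (idx : Pt (F.P K).d)
    (A : PBond (F.P K) 0 → MatA N) :
    NrmOfRecordWide F N Mc ρ ν M g K k s (1 : GaugeField (F.P K) 0 (SU N)) j idx (fun _ => 1 : GaugeTransf (F.P K) 0 (SU N)) A := by
  refine ⟨fun _ => 1, fun _ => rfl, fun i _ => ?_, fun hk j' _ y _ => ?_⟩
  · rw [gaugeAct_one_one]
    exact radialTower_one F N K i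
  · have hfun : (fun x : Site (F.P K) 0 => blockLift j (axialGaugeAt (Averaging.iter (avOfRecord F N K) j
        (gaugeAct (fun _ => 1 : GaugeTransf (F.P K) 0 (SU N)) (1 : GaugeField (F.P K) 0 (SU N))))
          (tLo (cornerP (F.P K) Mc ρ idx) ρ) (tHi (cornerP (F.P K) Mc ρ idx) (sideP (F.P K) Mc ρ) ρ) (ctr (cornerP (F.P K) Mc ρ idx) (sideP (F.P K) Mc ρ))) x *
          (fun _ => 1 : GaugeTransf (F.P K) 0 (SU N)) x * ((fun _ => 1 : GaugeTransf (F.P K) 0 (SU N)) x)⁻¹) = fun _ => 1 := by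
      funext x
      rw [gaugeAct_one_one, B15Claim189UnitTestAtRecord.iter_avOfRecord_one, axialGaugeAt_one]
      simp [blockLift]
    rw [hfun, gaugeAvgIter_loopAvgBlockOp_one expMeanLogSU (expMeanLogSU_E_one' N) j']

/-- ★★ **A6 CERTIFICATE FOR `HThm4Rec`'s CONCLUSION AT THE TRIVIAL FIELD**: for `κ > 0`, `ε_j > 0`, every run and every datum, the ∃-clause of `HThm4Rec` at `U := 1` holds with `u := 1`,
`A := 0` — every gauge row reads `1 = e^{0}`, every letter row `‖0‖ < κ·ε_j·(…)`, every (153) row is a linear map at `0`, and `NrmOfRecordWide … 1 j idx 1 0` by `nrmOfRecordWide_one`.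
(The premise itself is NOT proved by this; it shows its conclusion shape is consistent at the trivial point.) [cite: Balaban1985Variational, (152)–(153) p.301 (bookkeeping); Balaban1985RegularSpaces, (1.38) p.82] -/
theorem hThm4Rec_conclusion_at_one (Mc ρ : ℕ) {κ : ℝ} (hκ : 0 < κ) (ν : Stage7Numerics) (M : ℕ) (g : ℕ → ℝ) (K k : ℕ) (s : SeqOfRecord F ν M g K k)
    {ε : ℕ → ℝ} (j : ℕ) (hk : j ≤ (F.P K).m + (F.P K).K) (idx : Pt (F.P K).d) (hε : 0 < ε j) :
    ∃ (u : GaugeTransf (F.P K) 0 (SU N)) (A : PBond (F.P K) 0 → MatA N),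
      (∀ b ∈ (Sect2.regionOfSet (F.P K) (cover (F.P K) '' box (F.P K).L (cornerP (F.P K) Mc ρ idx) (sideP (F.P K) Mc ρ) j)).bonds,
        gaugeU (fun x => ιSU N (u x)) (fun b' => ιSU N ((1 : GaugeField (F.P K) 0 (SU N)) b')) b = expI ((F.P K).eta j) (A b)) ∧
      (∀ b ∈ (Sect2.regionOfSet (F.P K) (cover (F.P K) '' cube (F.P K).L (cornerP (F.P K) Mc ρ idx) (sideP (F.P K) Mc ρ) ρ j 0)).bonds,
        gaugeU (fun x => ιSU N (u x)) (fun b' => ιSU N ((1 : GaugeField (F.P K) 0 (SU N)) b')) b = expI ((F.P K).eta j) (A b)) ∧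
      (∀ j', j' ≤ j →
        ∀ b ∈ (Sect2.regionOfSet (F.P K) (cover (F.P K) '' cube (F.P K).L (cornerP (F.P K) Mc ρ idx) (sideP (F.P K) Mc ρ) ρ j j')).bonds,
          ‖A b‖ < κ * ε j * ((F.P K).L : ℝ) ^ (j - j')) ∧
      (∀ b ∈ (Sect2.regionOfSet (F.P K) (cover (F.P K) '' box (F.P K).L (cornerP (F.P K) Mc ρ idx) (sideP (F.P K) Mc ρ) j)).bonds,
        ‖A b‖ < κ * ε j) ∧
      (∀ q ∈ (Sect2.regionOfSet (F.P K) (cover (F.P K) '' box (F.P K).L (cornerP (F.P K) Mc ρ idx) (sideP (F.P K) Mc ρ) j)).dpairs,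
        ‖grad ((F.P K).eta j) q.2.1 (fun y => A ⟨y, q.2.2⟩) q.1‖ < κ * ε j) ∧
      (∀ b ∈ Sect2.bondsDeep (cover (F.P K) '' box (F.P K).L (cornerP (F.P K) Mc ρ idx) (sideP (F.P K) Mc ρ) j),
        ‖Sect2.codiffCurlA ((F.P K).eta j) A b.src b.dir‖ < κ * ε j) ∧
      (∀ b ∈ Sect2.bondsDeep (cover (F.P K) '' box (F.P K).L (cornerP (F.P K) Mc ρ idx) (sideP (F.P K) Mc ρ) j),
        ‖∑ ν' : Fin (F.P K).d, (((F.P K).eta j : ℝ) : ℂ)⁻¹ •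
            (grad ((F.P K).eta j) ν' (fun y => A ⟨y, b.dir⟩) (b.src.unshift ν') - grad ((F.P K).eta j) ν' (fun y => A ⟨y, b.dir⟩) b.src)‖ < κ * ε j) ∧
      (∀ φ : MatA N →L[ℂ] ℂ,
        RE (domainsMeet (cubeDomains (F.P K) (cornerP (F.P K) Mc ρ idx) (sideP (F.P K) Mc ρ) ρ j hk) (domainsOfSeq s.Ω j hk)) ((F.P K).eta j)⁻¹
            (dsE ((F.P K).eta j)⁻¹ (WithLp.toLp 2 fun b => (φ (A b)).re : BondSpace (F.P K))) = 0 ∧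
        RE (domainsMeet (cubeDomains (F.P K) (cornerP (F.P K) Mc ρ idx) (sideP (F.P K) Mc ρ) ρ j hk) (domainsOfSeq s.Ω j hk)) ((F.P K).eta j)⁻¹
            (dsE ((F.P K).eta j)⁻¹ (WithLp.toLp 2 fun b => (φ (A b)).im : BondSpace (F.P K))) = 0) ∧
      NrmOfRecordWide F N Mc ρ ν M g K k s (1 : GaugeField (F.P K) 0 (SU N)) j idx u A := by
  have hL : (1 : ℝ) ≤ (F.P K).L := by exact_mod_cast (F.P K).L_pos
  have hgauge : ∀ b : PBond (F.P K) 0, gaugeU (fun x => ιSU N ((fun _ => 1 : GaugeTransf (F.P K) 0 (SU N)) x)) (fun b' => ιSU N ((1 : GaugeField (F.P K) 0 (SU N)) b')) b =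
      expI ((F.P K).eta j) ((0 : PBond (F.P K) 0 → MatA N) b) := by
    intro b
    rw [Pi.zero_apply, B12RegularSpaces111Mono.expI_zero]
    show ιSU N 1 * ιSU N 1 * (ιSU N 1)⁻¹ = 1
    simp
  have hgrad : ∀ (ν' : Fin (F.P K).d) (x : Site (F.P K) 0), grad ((F.P K).eta j) ν' (fun _ : Site (F.P K) 0 => (0 : MatA N)) x = 0 := by
    intro ν' x; simp [grad]
  have hcurl : ∀ (x : Site (F.P K) 0) (ν' μ : Fin (F.P K).d), Sect2.curlA ((F.P K).eta j) (0 : PBond (F.P K) 0 → MatA N) x ν' μ = 0 := by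
    intro x ν' μ; simp [Sect2.curlA, grad]
  have hcodiff : ∀ (x : Site (F.P K) 0) (μ : Fin (F.P K).d), Sect2.codiffCurlA ((F.P K).eta j) (0 : PBond (F.P K) 0 → MatA N) x μ = 0 := by
    intro x μ; simp [Sect2.codiffCurlA, hcurl]
  have hpos : ∀ j' : ℕ, 0 < κ * ε j * ((F.P K).L : ℝ) ^ (j - j') := fun j' => by positivity
  have hκε : 0 < κ * ε j := mul_pos hκ hε
  refine ⟨fun _ => 1, 0, fun b _ => hgauge b, fun b _ => hgauge b, fun j' _ b _ => by simpa using hpos j', fun b _ => by simpa using hκε,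
    fun q _ => ?_, fun b _ => ?_, fun b _ => ?_, fun φ => ?_, nrmOfRecordWide_one Mc ρ ν M g K k s j idx 0⟩
  · have : grad ((F.P K).eta j) q.2.1 (fun y => (0 : PBond (F.P K) 0 → MatA N) ⟨y, q.2.2⟩) q.1 = 0 := hgrad q.2.1 q.1
    rw [this, norm_zero]; exact hκε
  · rw [hcodiff, norm_zero]; exact hκε
  · have : ∀ ν' : Fin (F.P K).d, (((F.P K).eta j : ℝ) : ℂ)⁻¹ •
        (grad ((F.P K).eta j) ν' (fun y => (0 : PBond (F.P K) 0 → MatA N) ⟨y, b.dir⟩) (b.src.unshift ν') -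
          grad ((F.P K).eta j) ν' (fun y => (0 : PBond (F.P K) 0 → MatA N) ⟨y, b.dir⟩) b.src) = 0 := by
      intro ν'
      rw [show (fun y => (0 : PBond (F.P K) 0 → MatA N) ⟨y, b.dir⟩) = fun _ : Site (F.P K) 0 => (0 : MatA N) from rfl, hgrad, hgrad, sub_self, smul_zero]
    rw [Finset.sum_eq_zero fun ν' _ => this ν', norm_zero]; exact hκε
  · have hre : (WithLp.toLp 2 fun b => (φ ((0 : PBond (F.P K) 0 → MatA N) b)).re : BondSpace (F.P K)) = 0 := by
      ext b; simp
    have him : (WithLp.toLp 2 fun b => (φ ((0 : PBond (F.P K) 0 → MatA N) b)).im : BondSpace (F.P K)) = 0 := by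
      ext b; simp
    rw [hre, him, map_zero, map_zero]
    exact ⟨rfl, rfl⟩

end Vacuity

end Summit.QuantumFields.YangMills.BalabanUVNodes.N07Thm4RecordStructure

end
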